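import Summits.FinalStateConjecture.FinalStateConjecture.Theorems.InertialRecession.Negative.KinematicShadow
import Summits.FinalStateConjecture.FinalStateConjecture.Theorems.InertialRecession.Negative.CleanScaleEncounters

/-!
# Negative knowledge for the crux `InertialRecession` (item stmt-FinalStateConjecture-10166), VIII:
under SEPARATION the clean-scale force bound freezes the INSTANTANEOUS velocity (one dimension)

Refuter file (D-0016 negative lane, `--supports stmt-FinalStateConjecture-10166`; cdisprove cycle 3).
No Theses decl is asserted. Builds on `CleanScaleCesaro.lean` (first-hit lemma `exists_first_hit`),
`CleanScaleEncounters.lean` (`speed_sq_le_of_turnaround`) and `KinematicShadow.lean`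
(`tendsto_of_integrableOn_deriv`). Companion: `CleanScaleFrozenTwoBody.lean` (the two-body toy in `ℝⁿ`).

CORRECTION OF A CYCLE-2 CLAIM. `Cruxes/InertialRecession/Disproof.lean` §E (cycle 2) said that below
the parabolic scale (`d_min ≲ t^{2/3}`, where the Landau–Hardy Tauberian condition `ξ'' ≥ -B/t` of
`CesaroTauberian.lean` fails) "a persistent sub-parabolic partner can keep an instantaneous velocity
wandering". In the toy this is FALSE: the separation clause h₄ of the crux (`‖ξᵢ - ξⱼ‖ → ∞`) upgrades
Cesàro velocities to FROZEN instantaneous velocities, with no rate and at every exponent `p > 1`, by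
energy arguments that never integrate the force along the trajectory.

`tendsto_deriv_of_abs_deriv2_le_rpow_of_tendsto_atTop`: `|s''| ≤ K s^{-p}` where `s > 0`, `p > 1`, and
`s → ∞` imply that `s'` CONVERGES. Descent at speed `A` from a large distance `d` can neither be turned
around (`speed_sq_le_of_turnaround`: a turnaround costs `A² ≤ 2K d^{1-p}/(p-1)`) nor go on forever
(`s → ∞`); ascent at speed `A` from a large distance persists at speed `> A/2` forever
(`ascent_persists`: the energy `s'²/2 - (K/(p-1)) s^{1-p}` is monotone while `s' > 0`), after which
`s ≳ t` and the force is integrable. So either `s'` is eventually inside every `(-A, A)`, i.e. `s' → 0`,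
or it converges by integrability. (Without separation only the Cesàro mean converges,
`tendsto_div_of_abs_deriv2_le_rpow`; at `p = 1` not even that, `CleanScaleSharpness.lean`.)
-/

set_option linter.dupNamespace false

noncomputable section

namespace Summit.FinalStateConjecture.FinalStateConjecture.Theorems.InertialRecession.Negative

open Filter Set MeasureTheory intervalIntegral
open scoped Topology

/-! ### Energy monotonicity during an ascent and the persistence of fast ascents -/

/-- **Energy gain during an ascent.** If `φ' > 0` on `[t₁, t₂)` and `φ'' ≥ -g(φ)` on `[t₁, t₂]`, where
`Ψ` is an antiderivative of `g` along the range, then `φ'²/2 + Ψ(φ)` does not decrease from `t₁` to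
`t₂`. [folklore] -/
theorem energy_ascent {φ φ' φ'' g Ψ : ℝ → ℝ} {t₁ t₂ : ℝ} (ht : t₁ ≤ t₂)
    (hφ : ∀ t ∈ Icc t₁ t₂, HasDerivAt φ (φ' t) t) (hφ' : ∀ t ∈ Icc t₁ t₂, HasDerivAt φ' (φ'' t) t)
    (hΨ : ∀ t ∈ Icc t₁ t₂, HasDerivAt Ψ (g (φ t)) (φ t))
    (hacc : ∀ t ∈ Icc t₁ t₂, -g (φ t) ≤ φ'' t) (hpos : ∀ t ∈ Ico t₁ t₂, 0 < φ' t) :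
    φ' t₁ ^ 2 / 2 + Ψ (φ t₁) ≤ φ' t₂ ^ 2 / 2 + Ψ (φ t₂) := by
  have hE : ∀ t ∈ Icc t₁ t₂, HasDerivAt (fun t ↦ φ' t ^ 2 / 2 + Ψ (φ t))
      (φ' t * φ'' t + g (φ t) * φ' t) t := by
    intro t ht'
    have hd1 : HasDerivAt (fun t ↦ φ' t ^ 2 / 2) (φ' t * φ'' t) t := by
      have := ((hφ' t ht').pow 2).div_const 2
      refine this.congr_deriv ?_
      simp only [Nat.cast_ofNat]
      ring
    have hd2 : HasDerivAt (fun t ↦ Ψ (φ t)) (g (φ t) * φ' t) t := (hΨ t ht').comp t (hφ t ht')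
    exact hd1.add hd2
  have hmono : MonotoneOn (fun t ↦ φ' t ^ 2 / 2 + Ψ (φ t)) (Icc t₁ t₂) := by
    refine monotoneOn_of_hasDerivWithinAt_nonneg (convex_Icc t₁ t₂)
      (fun t ht' ↦ (hE t ht').continuousAt.continuousWithinAt)
      (fun t ht' ↦ (hE t (interior_subset ht')).hasDerivWithinAt) ?_
    intro t ht'
    rw [interior_Icc] at ht'
    have h1 := hacc t ⟨ht'.1.le, ht'.2.le⟩
    have h2 := hpos t ⟨ht'.1.le, ht'.2⟩
    have : φ' t * φ'' t + g (φ t) * φ' t = φ' t * (φ'' t + g (φ t)) := by ring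
    rw [this]
    exact mul_nonneg h2.le (by linarith)
  exact hmono (left_mem_Icc.mpr ht) (right_mem_Icc.mpr ht) ht

/-- **Fast ascents persist.** In the setting of `energy_ascent` on `[t₁, t₂]`, if the potential `Ψ(φ)`
can drop by at most `B ≤ A²/4` along the interval and `φ'(t₁) ≥ A > 0`, then `φ' > A/2` on the whole
interval: at a first time with `φ' = A/2` the energy inequality would give `φ'² ≥ A² - 2B ≥ A²/2`.
[folklore] -/
theorem ascent_persists {φ φ' φ'' g Ψ : ℝ → ℝ} {t₁ t₂ A B : ℝ} (ht : t₁ ≤ t₂) (hA : 0 < A)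
    (hφ : ∀ t ∈ Icc t₁ t₂, HasDerivAt φ (φ' t) t) (hφ' : ∀ t ∈ Icc t₁ t₂, HasDerivAt φ' (φ'' t) t)
    (hΨ : ∀ t ∈ Icc t₁ t₂, HasDerivAt Ψ (g (φ t)) (φ t))
    (hacc : ∀ t ∈ Icc t₁ t₂, -g (φ t) ≤ φ'' t)
    (hdrop : ∀ t ∈ Icc t₁ t₂, ∀ t' ∈ Icc t₁ t₂, Ψ (φ t) - Ψ (φ t') ≤ B) (hB : B ≤ A ^ 2 / 4)
    (h₁ : A ≤ φ' t₁) : ∀ t ∈ Icc t₁ t₂, A / 2 < φ' t := by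
  by_contra hcon
  push Not at hcon
  obtain ⟨tb, htb, hle⟩ := hcon
  -- first time in `[t₁, tb]` with `φ' ≤ A / 2`
  have hcont' : ContinuousOn φ' (Icc t₁ t₂) := fun t ht' ↦ (hφ' t ht').continuousAt.continuousWithinAt
  have hsub0 : Icc t₁ tb ⊆ Icc t₁ t₂ := Icc_subset_Icc le_rfl htb.2
  have hclosed : IsClosed {t | t ∈ Icc t₁ tb ∧ φ' t ≤ A / 2} := by
    have := (hcont'.mono hsub0).preimage_isClosed_of_isClosed isClosed_Icc
      (isClosed_Iic (a := A / 2))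
    convert this using 1
    ext t
    simp
  have hnot : ¬ φ' t₁ ≤ A / 2 := by push Not; linarith
  obtain ⟨ts, h1s, hs2, hsP, hbefore⟩ := exists_first_hit (P := fun t ↦ φ' t ≤ A / 2) htb.1 hclosed
    hnot hle
  have hts : ts ∈ Icc t₁ t₂ := ⟨h1s.le, hs2.trans htb.2⟩
  have hsub : Icc t₁ ts ⊆ Icc t₁ t₂ := Icc_subset_Icc le_rfl hts.2
  -- energy inequality on `[t₁, ts]`
  have hen := energy_ascent h1s.le (fun t ht' ↦ hφ t (hsub ht')) (fun t ht' ↦ hφ' t (hsub ht'))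
    (fun t ht' ↦ hΨ t (hsub ht')) (fun t ht' ↦ hacc t (hsub ht'))
    (fun t ht' ↦ by have := not_le.mp (hbefore t ht'); linarith)
  -- `φ' ts = A / 2` by continuity from the left
  have heq : φ' ts = A / 2 := by
    refine le_antisymm hsP ?_
    have hcts : ContinuousWithinAt φ' (Iio ts) ts := (hφ' ts hts).continuousAt.continuousWithinAt
    refine ge_of_tendsto hcts.tendsto ?_
    filter_upwards [Ico_mem_nhdsLT h1s] with t ht'
    exact (not_le.mp (hbefore t ht')).le
  have hd := hdrop ts hts t₁ (left_mem_Icc.mpr ht)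
  rw [heq] at hen
  have hA2 : 0 < A ^ 2 := by positivity
  nlinarith

/-! ### One dimension: separation freezes the velocity -/

/-- **Separation freezes the velocity (one dimension).** On `[t₀, ∞)` let `s` be twice differentiable
with `|s''| ≤ K s^{-p}` wherever `s > 0` (`p > 1`, `K ≥ 0`), and suppose `s(t) → ∞`. Then `s'`
CONVERGES. (No bound on `s'` and no integrability of `s''` along the trajectory are assumed; compare
`tendsto_div_of_abs_deriv2_le_rpow`, which gets only the Cesàro mean but needs no separation, and
`CleanScaleSharpness.lean`: at `p = 1` even the Cesàro mean wanders although `s → ∞`.) [folklore] -/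
theorem tendsto_deriv_of_abs_deriv2_le_rpow_of_tendsto_atTop {s s' s'' : ℝ → ℝ} {t₀ K p : ℝ}
    (hp : 1 < p) (hK : 0 ≤ K)
    (hs : ∀ t, t₀ ≤ t → HasDerivAt s (s' t) t) (hs' : ∀ t, t₀ ≤ t → HasDerivAt s' (s'' t) t)
    (hbound : ∀ t, t₀ ≤ t → 0 < s t → |s'' t| ≤ K * s t ^ (-p))
    (hsep : Tendsto s atTop atTop) : ∃ L, Tendsto s' atTop (𝓝 L) := by
  set c := K / (p - 1) with hc
  have hp1 : 0 < p - 1 := by linarith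
  have hc0 : 0 ≤ c := div_nonneg hK hp1.le
  -- for every `A > 0`: a distance `d` beyond which turnarounds / slow-downs of size `A` are impossible,
  -- and a time after which the trajectory stays beyond `d`
  have prep : ∀ A : ℝ, 0 < A → ∃ d a : ℝ, 0 < d ∧ 2 * K / (p - 1) * d ^ (1 - p) < A ^ 2 / 4 ∧
      ∀ t, a ≤ t → t₀ ≤ t ∧ d ≤ s t := by
    intro A hA
    have h1 : Tendsto (fun d : ℝ ↦ 2 * K / (p - 1) * d ^ (-(p - 1))) atTop (𝓝 (2 * K / (p - 1) * 0)) :=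
      (tendsto_rpow_neg_atTop hp1).const_mul _
    rw [mul_zero] at h1
    have h2 : ∀ᶠ d : ℝ in atTop, 2 * K / (p - 1) * d ^ (-(p - 1)) < A ^ 2 / 4 :=
      h1.eventually (gt_mem_nhds (by positivity))
    obtain ⟨d, hd1, hd2⟩ := (h2.and (eventually_ge_atTop 1)).exists
    have hev : ∀ᶠ t in atTop, t₀ ≤ t ∧ d ≤ s t :=
      (eventually_ge_atTop t₀).and (hsep.eventually (eventually_ge_atTop d))
    obtain ⟨a, ha⟩ := hev.exists_forall_of_atTop
    refine ⟨d, a, by linarith, ?_, ha⟩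
    convert hd1 using 3
    ring
  -- Step A: no late descent at speed `A`
  have stepA : ∀ A : ℝ, 0 < A → ∀ᶠ t in atTop, -A < s' t := by
    intro A hA
    obtain ⟨d, a, hd, hdA, ha⟩ := prep A hA
    refine eventually_atTop.mpr ⟨a, fun t₁ ht₁ ↦ ?_⟩
    by_contra hcon
    push Not at hcon
    by_cases hturn : ∃ t₂, t₁ ≤ t₂ ∧ 0 ≤ s' t₂
    · obtain ⟨t₂, h12, h2⟩ := hturn
      have key := speed_sq_le_of_turnaround (r := s) (r' := s') (r'' := s'') h12 hp hK hd
        (fun t ht' ↦ hs t (ha t (ht₁.trans ht'.1)).1) (fun t ht' ↦ hs' t (ha t (ht₁.trans ht'.1)).1)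
        (fun t ht' ↦ hbound t (ha t (ht₁.trans ht'.1)).1 (hd.trans_le (ha t (ht₁.trans ht'.1)).2))
        (fun t ht' ↦ (ha t (ht₁.trans ht'.1)).2) (by linarith) h2
      have : A ^ 2 ≤ s' t₁ ^ 2 := by nlinarith
      have hA2 : 0 < A ^ 2 := by positivity
      linarith
    · push Not at hturn
      -- `s' < 0` on `[t₁, ∞)`: `s` is antitone there, contradicting `s → ∞`
      have hanti : AntitoneOn s (Ici t₁) := by
        refine antitoneOn_of_hasDerivWithinAt_nonpos (convex_Ici t₁)
          (fun t ht' ↦ (hs t (ha t (ht₁.trans ht')).1).continuousAt.continuousWithinAt)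
          (fun t ht' ↦ (hs t (ha t (ht₁.trans (interior_subset ht'))).1).hasDerivWithinAt) ?_
        intro t ht'
        rw [interior_Ici] at ht'
        exact (hturn t (le_of_lt ht')).le
      have hev : ∀ᶠ t in atTop, s t₁ + 1 ≤ s t := hsep.eventually (eventually_ge_atTop _)
      obtain ⟨t, ht1, ht2⟩ := (hev.and (eventually_ge_atTop t₁)).exists
      have := hanti (self_mem_Ici) ht2 ht2
      linarith
  -- Step B: a late ascent at speed `A` persists at speed `A / 2`
  have stepB : ∀ A : ℝ, 0 < A → (∃ᶠ t in atTop, A ≤ s' t) → ∃ a', t₀ ≤ a' ∧ ∀ t, a' ≤ t → A / 2 < s' t := by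
    intro A hA hfreq
    obtain ⟨d, a, hd, hdA, ha⟩ := prep A hA
    obtain ⟨t₁, h1, ht₁⟩ := (hfreq.and_eventually (eventually_ge_atTop a)).exists
    refine ⟨t₁, (ha t₁ ht₁).1, fun t₂ ht₂ ↦ ?_⟩
    have hI : ∀ t ∈ Icc t₁ t₂, t₀ ≤ t ∧ d ≤ s t := fun t ht' ↦ ha t (ht₁.trans ht'.1)
    have hpos : ∀ t ∈ Icc t₁ t₂, 0 < s t := fun t ht' ↦ hd.trans_le (hI t ht').2
    refine ascent_persists (φ := s) (φ' := s') (φ'' := s'') (g := fun u ↦ K * u ^ (-p))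
      (Ψ := fun u ↦ -c * u ^ (1 - p)) (B := c * d ^ (1 - p)) ht₂ hA (fun t ht' ↦ hs t (hI t ht').1)
      (fun t ht' ↦ hs' t (hI t ht').1) ?_ ?_ ?_ ?_ h1 t₂ (right_mem_Icc.mpr ht₂)
    · intro t ht'
      have hst := hpos t ht'
      have := ((hasDerivAt_id (s t)).rpow_const (p := 1 - p) (Or.inl hst.ne')).const_mul (-c)
      refine this.congr_deriv ?_
      rw [hc, show (1 - p - 1 : ℝ) = -p by ring]
      simp only [id_eq, one_mul]
      field_simp
      ring
    · intro t ht'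
      have := hbound t (hI t ht').1 (hpos t ht')
      linarith [neg_abs_le (s'' t)]
    · intro t ht' t' ht''
      have h1' : d ^ (1 - p) ≥ s t' ^ (1 - p) :=
        Real.rpow_le_rpow_of_nonpos hd (hI t' ht'').2 (by linarith)
      have h2' : 0 ≤ s t ^ (1 - p) := Real.rpow_nonneg (hpos t ht').le _
      nlinarith
    · have : c * d ^ (1 - p) = (2 * K / (p - 1) * d ^ (1 - p)) / 2 := by rw [hc]; ring
      rw [this]
      have hA2 : 0 ≤ A ^ 2 := sq_nonneg A
      linarith
  -- Step C: either some speed level `A > 0` is reached frequently (then linear escape and an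
  -- integrable force), or `s' → 0`
  by_cases h : ∃ A : ℝ, 0 < A ∧ ∃ᶠ t in atTop, A ≤ s' t
  · obtain ⟨A, hA, hfreq⟩ := h
    obtain ⟨a', ha'₀, ha'⟩ := stepB A hA hfreq
    -- linear growth: `s t - (A/2) t` is monotone on `[a', ∞)`
    have hderiv : ∀ t, a' ≤ t → HasDerivAt (fun x ↦ s x - A / 2 * x) (s' t - A / 2) t := by
      intro t ht'
      have h2 : HasDerivAt (fun x : ℝ ↦ A / 2 * x) (A / 2) t := by
        simpa using (hasDerivAt_id t).const_mul (A / 2)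
      exact (hs t (ha'₀.trans ht')).sub h2
    have hmono : MonotoneOn (fun t ↦ s t - A / 2 * t) (Ici a') := by
      refine monotoneOn_of_hasDerivWithinAt_nonneg (convex_Ici a') (f' := fun t ↦ s' t - A / 2)
        (fun t ht' ↦ (hderiv t ht').continuousAt.continuousWithinAt)
        (fun t ht' ↦ (hderiv t (interior_subset ht')).hasDerivWithinAt) ?_
      intro t ht'
      rw [interior_Ici] at ht'
      have := ha' t (le_of_lt ht')
      linarith
    set T₁ : ℝ := max a' (max 1 (2 * a' - 4 * s a' / A)) with hT₁
    have hT₁a : a' ≤ T₁ := le_max_left _ _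
    have hT₁1 : (1 : ℝ) ≤ T₁ := (le_max_left _ _).trans (le_max_right _ _)
    have hlin : ∀ t, T₁ ≤ t → A / 4 * t ≤ s t := by
      intro t ht'
      have h1 := hmono (self_mem_Ici) (hT₁a.trans ht') (hT₁a.trans ht')
      simp only at h1
      have h2 : 2 * a' - 4 * s a' / A ≤ t := ((le_max_right _ _).trans (le_max_right _ _)).trans ht'
      have h3 : A / 4 * (2 * a' - 4 * s a' / A) = A / 2 * a' - s a' := by
        field_simp
        ring
      nlinarith
    have hpos : ∀ t, T₁ ≤ t → 0 < s t := fun t ht' ↦ by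
      have ht0 : 0 < t := by linarith
      exact lt_of_lt_of_le (by positivity : (0 : ℝ) < A / 4 * t) (hlin t ht')
    -- the force is dominated by an integrable power
    have hdom : ∀ t, T₁ ≤ t → |s'' t| ≤ K * (A / 4) ^ (-p) * t ^ (-p) := by
      intro t ht'
      have ht0 : 0 < t := by linarith
      refine (hbound t (ha'₀.trans (hT₁a.trans ht')) (hpos t ht')).trans ?_
      rw [mul_assoc, ← Real.mul_rpow (by positivity) ht0.le]
      exact mul_le_mul_of_nonneg_left
        (Real.rpow_le_rpow_of_nonpos (by positivity) (hlin t ht') (by linarith)) hK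
    have hint : IntegrableOn s'' (Ioi T₁) := by
      have hg : IntegrableOn (fun t : ℝ ↦ K * (A / 4) ^ (-p) * t ^ (-p)) (Ioi T₁) :=
        ((integrableOn_Ioi_rpow_of_lt (by linarith) (by linarith)).const_mul _)
      have hderiv : IntegrableOn (deriv s') (Ioi T₁) := by
        refine hg.mono' (measurable_deriv s').aestronglyMeasurable ?_
        rw [ae_restrict_iff' measurableSet_Ioi]
        filter_upwards with t ht'
        rw [(hs' t (ha'₀.trans (hT₁a.trans (le_of_lt ht')))).deriv, Real.norm_eq_abs]
        exact hdom t (le_of_lt ht')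
      exact hderiv.congr_fun (fun t ht' ↦ (hs' t (ha'₀.trans (hT₁a.trans (le_of_lt ht')))).deriv)
        measurableSet_Ioi
    exact ⟨_, tendsto_of_integrableOn_deriv (fun t ht' ↦ hs' t (ha'₀.trans (hT₁a.trans ht'))) hint⟩
  · push Not at h
    refine ⟨0, tendsto_order.2 ⟨fun A hA ↦ ?_, fun A hA ↦ ?_⟩⟩
    · have := stepA (-A) (by linarith)
      simpa using this
    · exact (h A hA)

end Summit.FinalStateConjecture.FinalStateConjecture.Theorems.InertialRecession.Negative

end
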